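import Summits.HodgeConjecture.HodgeConjecture.Theorems.Ring2AbelianAllAndreWeilPencilsAnchored
import Literature.AlgebraicGeometry.HodgeTheory.HodgeConjectureIsogenyInvariance
import HarnessLib

/-!
# Ring 2 · sub-cell AbelianAll (ALL ABELIAN VARIETIES), André axis, part M-e — THE ELLIPTIC ANCHORS UP TO ISOGENY: André's Lemme 6.3.3 (ii)
# «`X_{s₀}` isogène à une puissance d'une courbe elliptique» VERBATIM — a member (or chart) ISOGENOUS to a power of an elliptic curve anchors the
# pencil, with no named fact beyond Verdier

HONEST FRAMING (page 1, verbatim): **research route, not a corollary; conditional on HC_CM plus one named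
minimal statement.** Cell line: research route conditional on HC_CM; not a corollary; Q11.4-sentence-2
already refuted in dim ≥ 3. Nothing in this file proves a case of the Hodge conjecture or of `B(X)` for a named `X`: both rows are EQUIVALENCES between
displayed hypotheses. `HC_CM`, `HC_AV` and the global nodes do NOT occur. NAMED-FACT BINDER: `hGT` = Verdier 1976 (the ⟸ halves). Item
`Theses.RankFourFaces.CMToAbelian` (stmt-16267) stays OPEN; N104 untouched; no node is born (0 `def`, 0 `sorry`). Seat `pub-hodge-ring2-ab-andre-2`, gen 43 (part M).

## Content (theorems only; standard axioms)

Parts M-c §3 / M-d §3 anchored a pencil at a member (resp. a chart) ISOMORPHIC to `(E₀^{a+1})^{b+1}`. The Hodge conjecture is ISOGENY-INVARIANT for complex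
abelian varieties (van Geemen 1994 Lemma 3.7; the tree's `HodgeConjectureFor.of_isIsogenous`, fact-free), so the anchor may be a member / chart merely
ISOGENOUS to a power of an elliptic curve — André's hypothesis (ii) of Lemme 6.3.3 as printed:
* §1 **`lefschetzB_pencil_iff_forall_algebraicInvariants_of_isogenousEllipticMember_of_verdier`** — general compact abelian pencils (θ_N, group law, no odd
  invariants): a member charted by an abelian variety `B ≅ X_{s₀}` with `B` isogenous to `(E₀^{a+1})^{b+1}` and invariants of Hodge type at `s₀` ⟹
  **`B⋆(𝒳, η) ∀η ⟺` the invariant classes are algebraic on EVERY member**.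
* §2 **`lefschetzB_weilPencil_iff_forall_weilClasses_algebraic_of_isogenousEllipticChart_of_verdier`** — compact Weil pencils with their `K`-action (data of
  part M-d §2): the charting abelian variety `A_{s₀}` at one member isogenous to `(E₀^{a+1})^{b+1}` ⟹ **`B⋆(𝒳, η) ∀η ⟺ W(A_s, φ_s) ⊆ Nⁿ(A_s)` for EVERY member**.

## Honest status

Fact-free anchors modulo Verdier (⟸ halves). Such members exist in print on André's Lemme 6.3.3 pencils and at Deligne's tensor points `A₀ ⊗ K` (split type);
powers `E_L^{2n}` of a CM elliptic curve also carry `K`-Weil structures of NON-split discriminant (pen-and-paper, RING2-MAP §AbelianAll (ab-andre-2, gen 43)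
AA2.361 — not a kernel statement). Strength and node level unchanged; nothing minimal claimed; N104 untouched. EDGE LABELS: K (⟹) / K[Verdier] (⟸).
References: Andre1996Motifs (Lemme 6.3.3 (ii), p. 33); vanGeemen1994HodgeAV (Lemma 3.7, Thm. 4.3); Deligne1982HodgeCycles (§4 Remark 4.10); Tankeev2008 ((i), (ii));
Verdier1976 (Cor. (5.1)).
-/

noncomputable section

set_option linter.dupNamespace false

namespace Summit.HodgeConjecture.HodgeConjecture.Ring2.AbelianAll

open CategoryTheory CategoryTheory.Limits AlgebraicGeometry MonoidalCategory CartesianMonoidalCategory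
open Literature.AlgebraicGeometry Literature.AlgebraicGeometry.Motives
open Literature.AlgebraicGeometry.HodgeTheory Literature.AlgebraicGeometry.VanGeemen1994
open Literature.AlgebraicGeometry.Deligne1982 (hodgeConjectureFor_powSucc_powSucc)
open Literature.AlgebraicTopology.SingularHomology (singularCohomology)
open Summit.HodgeConjecture.HodgeConjecture.Theses
open Summit.HodgeConjecture.CorCM.Model

section Anchors

open scoped MonObj

variable {𝒳 S : SchemeOver ℂ} {f : 𝒳 ⟶ S}

/-- `𝒴` — the fibre square `𝒳 ×_S 𝒳` (display notation for the tree's `familyPullback f f`). -/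
local notation3 (prettyPrint := false) "𝒴[" f "]" => familyPullback f f
/-- `𝐚` — the first projection `𝒳 ×_S 𝒳 ⟶ 𝒳`. -/
local notation3 (prettyPrint := false) "𝐚[" f "]" => familyPullback.fst f f
/-- `𝐛` — the second projection `𝒳 ×_S 𝒳 ⟶ 𝒳`. -/
local notation3 (prettyPrint := false) "𝐛[" f "]" => familyPullback.snd f f

/-! ## §1 General pencils: a member isogenous to a power of an elliptic curve is an anchor -/

/-- **ANCHOR = A MEMBER ISOGENOUS TO A POWER OF AN ELLIPTIC CURVE** (André's Lemme 6.3.3 (ii) verbatim: «`X_{s₀}` isogène à une puissance d'une courbe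
elliptique»), NO named fact beyond Verdier. On a compact pencil of abelian `(k+1)`-folds with θ_N, a group law charted at `t`, no odd invariants at `t`, and a
member `X_{s₀}` charted by an abelian variety `B` ISOGENOUS to `(E₀^{a+1})^{b+1}` (`E₀` any elliptic curve) on which the invariant classes are of Hodge type:
**`B⋆(𝒳, η) ∀η ⟺` the invariant classes are algebraic on EVERY member.** All Hodge classes of the power are algebraic (the tree's
`hodgeConjectureFor_powSucc_powSucc`), the Hodge conjecture is isogeny-invariant (the tree's `HodgeConjectureFor.of_isIsogenous`, van Geemen Lemma 3.7), and
part M-c's HC-member anchor applies. [cite: Andre1996Motifs, Lemme 6.3.3 (ii) and its proof (p. 33)] [cite: vanGeemen1994HodgeAV, §3.6–3.7 Lemma 3.7 and Thm. 4.3]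
[cite: Tankeev2008, Thm. (i)–(ii)] [cite: Verdier1976, Cor. (5.1)] -/
theorem lefschetzB_pencil_iff_forall_algebraicInvariants_of_isogenousEllipticMember_of_verdier {k : ℕ}
    (hGT : Verdier1976_genericLocalTriviality) (hf : IsCompactAbelianPencil f (k + 1))
    (t : ComplexPoints S) (ν : 𝒳 ⟶ 𝒳) (hν : ν ≫ f = f) {N : ℕ} (hN : 2 ≤ N)
    (hθ : ∀ s : ComplexPoints S, ∃ (νs : fiberOver f s ⟶ fiberOver f s) (A : AbelianVariety ℂ) (e : A.X ≅ fiberOver f s),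
      νs ≫ fiberι f s = fiberι f s ≫ ν ∧ e.hom ≫ νs = (N • 𝟙 A).hom.hom.hom ≫ e.hom)
    (mS : 𝒴[f] ⟶ 𝒳)
    (hmν : (familyPullback.isPullback f f).lift (𝐚[f] ≫ ν) (𝐛[f] ≫ ν) (familyPullback_pair_condition hν) ≫ mS = mS ≫ ν)
    (hchart : ∃ (νt : fiberOver f t ⟶ fiberOver f t) (A : AbelianVariety ℂ) (e : A.X ≅ fiberOver f t),
      νt ≫ fiberι f t = fiberι f t ≫ ν ∧ e.hom ≫ νt = (N • 𝟙 A).hom.hom.hom ≫ e.hom ∧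
      (familyPullback.isPullback f f).lift (fst A.X A.X ≫ e.hom ≫ fiberι f t) (snd A.X A.X ≫ e.hom ≫ fiberι f t)
        (fibreChart_pair_condition t e) ≫ mS = μ[A.X] ≫ e.hom ≫ fiberι f t)
    (hOdd : ∀ k' : ℕ, Odd k' → k' ≤ 2 * (k + 1) → ∀ W : complexBetti 𝒳 k', complexBetti.map (fiberι f t) k' W = 0)
    {s₀ : ComplexPoints S} (B : AbelianVariety ℂ) (eB : B.X ≅ fiberOver f s₀)
    {E₀ : AbelianVariety ℂ} (hE : E₀.dim = 1) (a b : ℕ) (hiso : B.IsIsogenous ((E₀.powSucc a).powSucc b))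
    (hHodge : ∀ p : ℕ, 0 < p → p < k + 1 → ∀ W : complexBetti 𝒳 (2 * p),
      IsOfHodgeType (k + 1) (fiberOver f s₀) (2 * p) p p (complexBetti.map (fiberι f s₀) (2 * p) W)) :
    (∀ ηX : complexBetti 𝒳 2, StandardConjectureBStar (k + 1 + 1) 𝒳 ηX) ↔
      ∀ (s : ComplexPoints S) (p : ℕ), 0 < p → p < k + 1 → ∀ W : complexBetti 𝒳 (2 * p),
        complexBetti.map (fiberι f s) (2 * p) W ∈ algebraicClasses (fiberOver f s) p := by
  have hB : HodgeConjectureFor B.dim B.X := HodgeConjectureFor.of_isIsogenous hiso (hodgeConjectureFor_powSucc_powSucc hE a b)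
  have hdB : B.dim = k + 1 := Andre1996.compactPencil_dim_eq_of_iso hf eB
  have hs₀ : HodgeConjectureFor (k + 1) (fiberOver f s₀) := by
    rw [hdB] at hB
    exact (Ring2.Hypotheses.hodgeConjectureFor_iff_of_iso eB).1 hB
  exact lefschetzB_pencil_iff_forall_algebraicInvariants_of_hodgeConjectureFor_member_of_verdier hGT hf t ν hν hN hθ mS hmν hchart hOdd
    hHodge hs₀

/-! ## §2 Weil pencils with their `K`-action: a chart isogenous to a power of an elliptic curve is an anchor -/

/-- **ANCHOR = A CHART ISOGENOUS TO A POWER OF AN ELLIPTIC CURVE, for a compact Weil pencil with its `K`-action** (data as in part M-d §2, Weil type at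
the charted member `t`): if the charting abelian variety `A_{s₀}` at ONE member is isogenous to `(E₀^{a+1})^{b+1}`, then **`B⋆(𝒳, η) ∀η ⟺ W(A_s, φ_s) ⊆ Nⁿ(A_s)`
for EVERY member** — `A_{s₀}` satisfies the Hodge conjecture by isogeny invariance, and part M-d's HC-chart anchor applies. No named fact beyond Verdier.
[cite: Andre1996Motifs, Lemme 6.3.3 (ii) and its proof (p. 33)] [cite: vanGeemen1994HodgeAV, §3.6–3.7 Lemma 3.7, 4.9 and Thm. 4.3]
[cite: Deligne1982HodgeCycles, §4 Remark 4.10] [cite: Tankeev2008, Thm. (i)–(ii)] [cite: Verdier1976, Cor. (5.1)] -/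
theorem lefschetzB_weilPencil_iff_forall_weilClasses_algebraic_of_isogenousEllipticChart_of_verdier
    (hGT : Verdier1976_genericLocalTriviality) {q dK : ℕ} (hf : IsCompactAbelianPencil f (2 * q + 1 + 1))
    (t : ComplexPoints S) (ν : 𝒳 ⟶ 𝒳) (hν : ν ≫ f = f) {N : ℕ} (hN : 2 ≤ N)
    (hθ : ∀ s : ComplexPoints S, ∃ (νs : fiberOver f s ⟶ fiberOver f s) (A : AbelianVariety ℂ) (e : A.X ≅ fiberOver f s),
      νs ≫ fiberι f s = fiberι f s ≫ ν ∧ e.hom ≫ νs = (N • 𝟙 A).hom.hom.hom ≫ e.hom)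
    (mS : 𝒴[f] ⟶ 𝒳)
    (hmν : (familyPullback.isPullback f f).lift (𝐚[f] ≫ ν) (𝐛[f] ≫ ν) (familyPullback_pair_condition hν) ≫ mS = mS ≫ ν)
    (hchart : ∃ (νt : fiberOver f t ⟶ fiberOver f t) (A : AbelianVariety ℂ) (e : A.X ≅ fiberOver f t),
      νt ≫ fiberι f t = fiberι f t ≫ ν ∧ e.hom ≫ νt = (N • 𝟙 A).hom.hom.hom ≫ e.hom ∧
      (familyPullback.isPullback f f).lift (fst A.X A.X ≫ e.hom ≫ fiberι f t) (snd A.X A.X ≫ e.hom ≫ fiberι f t)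
        (fibreChart_pair_condition t e) ≫ mS = μ[A.X] ≫ e.hom ≫ fiberι f t)
    (hRank : ∀ p : ℕ, 0 < p → p < 2 * q + 1 + 1 → p ≠ q + 1 →
      Module.finrank ℂ (LinearMap.range (complexBetti.map (fiberι f t) (2 * p)).hom) = 1)
    (hOdd : ∀ k' : ℕ, Odd k' → k' ≤ 2 * (2 * q + 1 + 1) → ∀ W : complexBetti 𝒳 k', complexBetti.map (fiberι f t) k' W = 0)
    (Φ : 𝒳 ⟶ 𝒳) (hΦ : Φ ≫ f = f)
    (A : ComplexPoints S → AbelianVariety ℂ) (e : ∀ s, (A s).X ≅ fiberOver f s) (φ : ∀ s, A s ⟶ A s)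
    (hφ : ∀ s, φ s ≫ φ s = -(dK • 𝟙 (A s)))
    (hK : ∀ s, ∃ Φs : fiberOver f s ⟶ fiberOver f s, Φs ≫ fiberι f s = fiberι f s ≫ Φ ∧ (e s).hom ≫ Φs = (φ s).hom.hom.hom ≫ (e s).hom)
    (Θ Up Um : complexBetti 𝒳 (2 * (q + 1)))
    (hspan : ∀ W : complexBetti 𝒳 (2 * (q + 1)), ∃ a b c : ℂ, (complexBetti.map (fiberι f t) (2 * (q + 1))).hom W =
      a • (complexBetti.map (fiberι f t) (2 * (q + 1))).hom Θ + b • (complexBetti.map (fiberι f t) (2 * (q + 1))).hom Up +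
        c • (complexBetti.map (fiberι f t) (2 * (q + 1))).hom Um)
    (hΘ : ∀ s : ComplexPoints S, (complexBetti.map (fiberι f s) (2 * (q + 1))).hom Θ ∈ algebraicClasses (fiberOver f s) (q + 1))
    (hUpt : complexBetti.map (e t).hom (2 * (q + 1)) (complexBetti.map (fiberι f t) (2 * (q + 1)) Up) ∈ weilClassesPlus (A t) (φ t) (q + 1) dK)
    (hUmt : complexBetti.map (e t).hom (2 * (q + 1)) (complexBetti.map (fiberι f t) (2 * (q + 1)) Um) ∈ weilClassesMinus (A t) (φ t) (q + 1) dK)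
    (hUp0 : complexBetti.map (fiberι f t) (2 * (q + 1)) Up ≠ 0) (hWt : IsWeilType (A t) (φ t) (q + 1) dK)
    {s₀ : ComplexPoints S} {E₀ : AbelianVariety ℂ} (hE : E₀.dim = 1) (a b : ℕ) (hiso : (A s₀).IsIsogenous ((E₀.powSucc a).powSucc b)) :
    (∀ ηX : complexBetti 𝒳 2, StandardConjectureBStar (2 * q + 1 + 1 + 1) 𝒳 ηX) ↔
      ∀ s : ComplexPoints S, weilClassesOf (A s) (φ s) (q + 1) dK ≤ algebraicClasses (A s).X (q + 1) :=
  lefschetzB_weilPencil_iff_forall_weilClasses_algebraic_of_hodgeConjectureFor_chart_of_verdier hGT hf t ν hν hN hθ mS hmν hchart hRank hOdd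
    Φ hΦ A e φ hφ hK Θ Up Um hspan hΘ hUpt hUmt hUp0 hWt
    (HodgeConjectureFor.of_isIsogenous hiso (hodgeConjectureFor_powSucc_powSucc hE a b))

end Anchors

end Summit.HodgeConjecture.HodgeConjecture.Ring2.AbelianAll

end
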